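import Summits.QuantumFields.GaugeBoot.TiltedBoxCovariantLinkRP
import Summits.QuantumFields.GaugeBoot.ClassBLimitLinkCutWordBlocks
import HarnessLib

/-!
# Covariant link RP of the tilted (Class-T) limit points along the axes `k ∉ {i, j}`, and their
cut-loop `R_link` word blocks (gauge-boot, tilted family, covariant link blocks 2/2)

HONEST FRAMING (cell `pub-gaugeboot`, page 1 of every file): the venture produces certified bounds
on lattice expectations at stated coupling, gauge group, dimension and torus size; NOT a mass gap,
NOT a continuum limit, NOT a string tension; NOT Yang–Mills-summit-bearing (barriers
`FixedCouplingUltralocality`, `PerturbativeInvisibility`). Structural facts about a class of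
infinite-volume Wilson states (which SDP blocks are exact for them); certifies no number.

## Content

`TiltedBoxLimitAxisRP.lean` proved PLAIN link reflection positivity of every tilted limit point
`μ ∈ tiltedBoxLimitPoints d i j ρ β` along every axis `k ∉ {i, j}` (the `linkRP k` field of
`TiltedClassState`). Here, from the covariant box theorem and the lift geometry of
`TiltedBoxCovariantLinkRP.lean`, by the same Osterwalder–Seiler limit
(`IsTiltedBoxLimitAlong.integral_nonneg_of_eventually`):

* ★★★ **`covariantLinkRP_of_mem_tiltedBoxLimitPoints`** — `IsCovariantLinkRP k μ`
  (`ZdCovariantLinkRP.lean`) for every tilted limit point, every `k ∉ {i, j}`, `β ≥ 0`, continuous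
  `ρ`, compact second countable `G`;
* hence (`ClassBLinkCutWordBlocks.lean`, `ClassBLimitLinkCutWordBlocks.lean`) Kazakov–Zheng's
  link-type CUT-LOOP `R_link` word blocks along `k` are positive semidefinite for every tilted limit
  point: `sum_conj_mul_integral_trace_linkCutGlue_nonneg_of_mem_tiltedBoxLimitPoints` (glued-loop
  trace entries, every continuous representation `τ`, complex coefficients),
  ★★★ `rLinkCutWordBlock_nonneg_of_mem_tiltedBoxLimitPoints` (loop-variable entries
  `(1/N) Re tr ρ`, real coefficients, `decide`-able half-word test `Word.zdLinkHalfOK`);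
* `integral_wordLoopZd_plaquette_nonneg_of_mem_tiltedBoxLimitPoints` — the `1 × 1` block:
  `0 ≤ ∫ W_p(P_{kl}) dμ` for `p_k = 0`, `l ≠ k`.

So for Class-T limit points the exact SDP constraint list now reads: Gram, loop equations
(Haar shift), translations, `(i j)` and coordinate reflections, `R_diag(i, j)` cut-words,
`R_site(k)` cut-words and `R_link(k)` CUT-words [NEW] for `k ∉ {i, j}`. Nothing is claimed along
the in-plane axes `i`, `j`, nor for an abstract `TiltedClassState` (whose `linkRP` axiom is the
plain form). [folklore] mechanism (Osterwalder–Seiler 1978 §2; Kazakov–Zheng arXiv:2203.11360 §3.1).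
-/

noncomputable section

open MeasureTheory Filter Topology
open scoped ComplexOrder ComplexConjugate
open Literature.Probability.LatticeModels (Site)
open Literature.MathematicalPhysics.QuantumLattice

namespace Summit.QuantumFields.GaugeBoot

namespace TiltedRP

variable {d : ℕ} {i j k : Fin d} {N M : ℕ}
variable {G : Type*} [Group G] [TopologicalSpace G] [IsTopologicalGroup G] [CompactSpace G]
  [MeasurableSpace G] [BorelSpace G] [SecondCountableTopology G]
variable (ρ : G →* Matrix (Fin N) (Fin N) ℂ) (τ : G →* Matrix (Fin M) (Fin M) ℂ)

/-! ## The covariant link RP of the limit points -/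

/-- ★★★ **Covariant link RP of every tilted limit point along `k ∉ {i, j}`** (`β ≥ 0`, continuous
`ρ`): `IsCovariantLinkRP k μ` — the covariant (Osterwalder–Seiler half-link) form of
`ZdCovariantLinkRP.lean`. The box pairings of the lifted covariant data are non-negative for all
boxes of the defining family with `Q_n ≥ m` (`box_cov_nonneg`) and converge to `∫ Φ dμ`. -/
theorem covariantLinkRP_of_mem_tiltedBoxLimitPoints (hki : k ≠ i) (hkj : k ≠ j) (hρ : Continuous ρ)
    {β : ℝ} (hβ : 0 ≤ β) {μ : Measure (LGConfig d G)} (hμ : μ ∈ tiltedBoxLimitPoints d i j ρ β) :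
    IsCovariantLinkRP k μ := by
  intro n g T hT hgm hgT hgb Φ S hΦS hΦc hΦb hcov
  obtain ⟨Ms, Qs, -, hQ, h⟩ := hμ
  obtain ⟨Cg, hCg⟩ := hgb
  obtain ⟨C, hC⟩ := hΦb
  -- a common bound on the `k`-coordinates of the supports
  obtain ⟨m, hSm, hTm⟩ : ∃ m : ℕ, (∀ e ∈ S, -(m : ℤ) ≤ e.1 k ∧ e.1 k ≤ m) ∧
      ∀ e ∈ T, e.1 k ≤ m := by
    refine ⟨(S ∪ T).sup fun e => (e.1 k).natAbs, fun e he => ?_, fun e he => ?_⟩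
    · have h := Finset.le_sup (f := fun e : ZdEdge d => (e.1 k).natAbs) (Finset.mem_union_left T he)
      constructor <;> omega
    · have h := Finset.le_sup (f := fun e : ZdEdge d => (e.1 k).natAbs) (Finset.mem_union_right S he)
      omega
  refine h.integral_nonneg_of_eventually hρ hΦS hΦc hC ?_
  have hev : ∀ᶠ n in atTop, m ≤ Qs n := hQ.eventually_ge_atTop m
  refine hev.mono fun n hn => ?_
  exact box_cov_nonneg ρ hki hkj (by omega) hρ hβ hT hgm hgT hCg hΦS hΦc.measurable hcov hSm hTm
    (by omega)

/-! ## The cut-loop `R_link` word blocks of Class-T limit points -/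

/-- **Cut-loop `R_link` blocks of tilted limit points, glued-loop trace entries, every
representation** (`k ∉ {i, j}`, `β ≥ 0`): sites `p, q` with `p_k = q_k = 0`, half-words
`O_a : p + e_k → q + e_k` whose holonomies depend only on `linkHalfEdges k`, continuous `τ`,
`c ∈ ℂ^n`: `0 ≤ Σ_{ab} c̄_a c_b ∫ tr τ(hol_p([+e_k] · O_b · [-e_k] · (flip_k O_a)⁻¹)) dμ`. -/
theorem sum_conj_mul_integral_trace_linkCutGlue_nonneg_of_mem_tiltedBoxLimitPoints (hki : k ≠ i)
    (hkj : k ≠ j) (hρ : Continuous ρ) (hτ : Continuous τ) {β : ℝ} (hβ : 0 ≤ β)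
    {μ : Measure (LGConfig d G)} (hμ : μ ∈ tiltedBoxLimitPoints d i j ρ β) {p q : Fin d → ℤ}
    (hp : p k = 0) (hq : q k = 0) {n : ℕ} (O : Fin n → Word d)
    (hend : ∀ a, Word.endpointZd (p + Pi.single k 1) (O a) = q + Pi.single k 1)
    (hhalf : ∀ a, DependsOn (fun U : LGConfig d G => wordHolonomyZd U (p + Pi.single k 1) (O a))
      (linkHalfEdges k))
    (c : Fin n → ℂ) :
    0 ≤ ∑ a, ∑ b, conj (c a) * c b * ∫ U, (τ (wordHolonomyZd U p
      (Step.fwd k :: (O b ++ Step.bwd k :: Word.reverse ((O a).map (Step.flipAt k)))))).trace ∂μ := by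
  haveI := isProbabilityMeasure_of_mem_tiltedBoxLimitPoints hμ
  exact sum_conj_mul_integral_trace_linkCutGlue_nonneg τ hτ
    (covariantLinkRP_of_mem_tiltedBoxLimitPoints ρ hki hkj hρ hβ hμ) hp hq O hend hhalf c

/-- ★★★ **Cut-loop `R_link` blocks of tilted (Class-T) limit points with loop-variable entries,
decidable hypotheses** (`k ∉ {i, j}`, `β ≥ 0`, continuous `ρ`): sites `p, q` with
`p_k = q_k = 0`, words `O_a : p + e_k → q + e_k` with `Word.zdLinkHalfOK k (O a) (p + e_k)`, real `c`:
`0 ≤ Σ_{ab} c_a c_b ∫ W_p([+e_k] · O_b · [-e_k] · (flip_k O_a)⁻¹) dμ` — Kazakov–Zheng's link-type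
positivity matrices along `k` are exact constraints for tilted limit points. -/
theorem rLinkCutWordBlock_nonneg_of_mem_tiltedBoxLimitPoints (hki : k ≠ i) (hkj : k ≠ j)
    (hρ : Continuous ρ) {β : ℝ} (hβ : 0 ≤ β) {μ : Measure (LGConfig d G)}
    (hμ : μ ∈ tiltedBoxLimitPoints d i j ρ β) {p q : Fin d → ℤ} (hp : p k = 0) (hq : q k = 0)
    {n : ℕ} (O : Fin n → Word d)
    (hend : ∀ a, Word.endpointZd (p + Pi.single k 1) (O a) = q + Pi.single k 1)
    (hhalf : ∀ a, Word.zdLinkHalfOK k (O a) (p + Pi.single k 1) = true) (c : Fin n → ℝ) :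
    0 ≤ ∑ a, ∑ b, c a * c b * ∫ U, wordLoopZd ρ p
      (Step.fwd k :: (O b ++ Step.bwd k :: Word.reverse ((O a).map (Step.flipAt k)))) U ∂μ := by
  haveI := isProbabilityMeasure_of_mem_tiltedBoxLimitPoints hμ
  exact rLinkCutWordBlock_nonneg_of_zdLinkHalfOK ρ hρ
    (covariantLinkRP_of_mem_tiltedBoxLimitPoints ρ hki hkj hρ hβ hμ) hp hq O hend hhalf c

/-- ★ **The plaquette expectation of a tilted limit point is non-negative via link RP along
`k ∉ {i, j}`** (`β ≥ 0`): `0 ≤ ∫ W_p(P_{kl}) dμ` for `p_k = 0`, `l ≠ k` — the `1 × 1` cut-loop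
block. -/
theorem integral_wordLoopZd_plaquette_nonneg_of_mem_tiltedBoxLimitPoints (hki : k ≠ i)
    (hkj : k ≠ j) (hρ : Continuous ρ) {β : ℝ} (hβ : 0 ≤ β) {μ : Measure (LGConfig d G)}
    (hμ : μ ∈ tiltedBoxLimitPoints d i j ρ β) {p : Fin d → ℤ} (hp : p k = 0) {l : Fin d}
    (hl : l ≠ k) : 0 ≤ ∫ U, wordLoopZd ρ p (Word.plaquette k l) U ∂μ := by
  haveI := isProbabilityMeasure_of_mem_tiltedBoxLimitPoints hμ
  exact integral_wordLoopZd_plaquette_nonneg_of_isCovariantLinkRP ρ hρ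
    (covariantLinkRP_of_mem_tiltedBoxLimitPoints ρ hki hkj hρ hβ hμ) hp hl

end TiltedRP

end Summit.QuantumFields.GaugeBoot
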